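/-
Copyright (c) 2026 the pub-hodgecm-mathlib formalisation cell (harness21).  Prover seat hodgecm-mathlib-K2E3-p23 (g4), Track B «K2-LIT» ∕ h413
(`stmt-HodgeConjecture-24833`), line `K2_E3_EllipticInputs`, (SC-an) road «FC» (line lead K2E3-p14 (g4)), brick (FC-8) — unimodularity of the model group.  2026-09-04.
-/
import Summits.HodgeConjecture.HodgeConjecture.Theorems.K2E3FinConjCartanCover       -- ★ (FC-8 F1) p857230 (this seat): `center_le_unitaryInt`, `comap_glInt_eq_unitaryInt`; brings ★ Cartan, ★ `exists_inv_pow_eq`, ★ `unitaryInt` compact open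
import Literature.MeasureTheory.Group.HaarRightInvariantCompactSubgroup               -- ★ `modularCharacter_eq_one_of_mem_isCompact`; brings ★ `map_mul_right_eq_modularCharacter_smul`
import HarnessLib

/-!
# Crux `H413` — K2-LIT E3, (SC-an) road «FC», brick (FC-8): `U(σ, Φ₃)(K)` IS UNIMODULAR — every Haar measure on the quasi-split rank-one unitary group over a
# non-archimedean local field is right invariant (elementary proof from the Cartan decomposition)

Cell `hodgecm-mathlib`, Track B, line `K2_E3_EllipticInputs`, socket U12 :255 (SC-an) via road «FC» of K2E3-p14 (g4); seat K2E3-p23 (g4).  THEOREMS ONLY; count-neutral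
helper (`--supports stmt-HodgeConjecture-24833 --as helper`).  Discharges the `[μ.IsMulRightInvariant]` binder that the (FC) bricks ★ FC-A∕FC-B∕F2∕F3a carry and
that ★ (M5e-1) `K2E3SupercuspBallBoundSplitAssembly` takes as the hypothesis `hunimod`, so that the final `finConj` is stated over `[μ.IsHaarMeasure]` alone (the
shape of ★ FC-9 `ellWeightPlace_of_finConj`'s `hFC`).

THE MATHEMATICS (no structure theory beyond ★ Cartan).  Let `Δ : U → ℝ_{>0}` be the modular character.  `Δ = 1` on the compact open `K₀ = U ∩ GL₃(𝒪)` (★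
`modularCharacter_eq_one_of_mem_isCompact`).  For the ray `a = d(ϖ,1,(σϖ)⁻¹)`, ★ `exists_inv_pow_eq` gives `(aⁿ)⁻¹ = k₁ aⁿ k₂` with `kᵢ ∈ K₀`, hence
`Δ(aⁿ)⁻¹ = Δ(aⁿ)`, so `Δ(aⁿ) = 1`.  By ★ `exists_cartan_of_involution` every `g = k₁ aⁿ k₂ z` with `z` central, and `Z(U) ≤ K₀` (★ F1 `center_le_unitaryInt`), so
`Δ ≡ 1`, i.e. `(· g)_* μ = Δ(g) • μ = μ`.
* `modularCharacter_pow_ray_eq_one`, **`modularCharacter_eq_one`**, **`isMulRightInvariant_of_isHaarMeasure`**.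

HONEST LABEL: HC_CM is proved only modulo the 7 printed citations (2 remaining named inputs: hLiu418 = stmt-HodgeConjecture-24832, h413 =
stmt-HodgeConjecture-24833) until rung 0 closes; local structure theory, closes no organ by itself.

## References
* [Folland1995] G. B. Folland, *A Course in Abstract Harmonic Analysis* (1995), §2.4 (the modular function; Prop. 2.27 `Δ = 1` on compact subgroups).
* [BruhatTits1972] F. Bruhat, J. Tits, *Groupes réductifs sur un corps local I*, Publ. Math. IHÉS 41 (1972), (4.4.3) (Cartan decomposition).
* [Cartier1979] P. Cartier, *Representations of p-adic groups: a survey*, Proc. Sympos. Pure Math. 33.1 (1979), §I.3 (reductive `p`-adic groups are unimodular).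
-/

set_option autoImplicit false
-- the mandated namespace repeats `HodgeConjecture.HodgeConjecture`, as in every `Theorems/*.lean` of this sub-problem
set_option linter.dupNamespace false

noncomputable section

open MeasureTheory MeasureTheory.Measure Set
open scoped ENNReal NNReal MatrixGroups WithZero Valued

namespace Summit.HodgeConjecture.HodgeConjecture.Cruxes.H413.K2E3RankOneUnitaryUnimodular

open Literature.NumberTheory.Automorphic Literature.NumberTheory.Automorphic.UnitaryGroup Literature.NumberTheory.Automorphic.HermitianLattice
open Literature.MeasureTheory.Group K2E3FinConjCartanCover

variable {K : Type*} [Field K] [Valued K ℤᵐ⁰] [ValuativeRel K] [(Valued.v : Valuation K ℤᵐ⁰).Compatible] [CompactSpace 𝒪[K]]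
  (σ : K →+* K) {J : Matrix (Fin 3) (Fin 3) K} (hJ : J = (StdForm.antidiagonal 3).over K)
  [SecondCountableTopology ↥(unitaryGroupOfForm σ J)] [LocallyCompactSpace ↥(unitaryGroupOfForm σ J)]
  [MeasurableSpace ↥(unitaryGroupOfForm σ J)] [BorelSpace ↥(unitaryGroupOfForm σ J)]

include hJ in
/-- **`Δ(aⁿ) = 1` on the torus ray**: `(aⁿ)⁻¹ = k₁ aⁿ k₂` with `kᵢ ∈ K₀` compact (★ `exists_inv_pow_eq`), so `Δ(aⁿ)⁻¹ = Δ(aⁿ)` in `ℝ≥0`. [cite: Folland1995, §2.4 Prop. 2.27]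
[cite: BruhatTits1972, (4.4.3)] -/
theorem modularCharacter_pow_ray_eq_one (hσ : ∀ x, σ (σ x) = x) (hσv : ∀ x, Valued.v (σ x) = Valued.v x) {ϖ : K} (hϖ0 : ϖ ≠ 0)
    (a : ↥(unitaryGroupOfForm σ J)) (ha : ((a : GL (Fin 3) K) : Matrix (Fin 3) (Fin 3) K) = Matrix.diagonal ![ϖ, 1, (σ ϖ)⁻¹]) (n : ℕ) :
    modularCharacter (a ^ n) = 1 := by
  have hKc : IsCompact (unitaryInt σ J : Set ↥(unitaryGroupOfForm σ J)) := isCompact_unitaryInt_of_forall_v_eq hσv J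
  obtain ⟨k₁, hk₁, k₂, hk₂, hinv⟩ := exists_inv_pow_eq σ hJ hσ hσv hϖ0 a ha n
  rw [comap_glInt_eq_unitaryInt σ hJ hσv] at hk₁ hk₂
  have h1 : modularCharacter ((a ^ n)⁻¹) = modularCharacter (a ^ n) := by
    rw [hinv, map_mul, map_mul, Literature.MeasureTheory.Group.modularCharacter_eq_one_of_mem_isCompact (unitaryInt σ J) hKc hk₁,
      Literature.MeasureTheory.Group.modularCharacter_eq_one_of_mem_isCompact (unitaryInt σ J) hKc hk₂, one_mul, mul_one]
  rw [map_inv] at h1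
  -- `x⁻¹ = x` with `x > 0` forces `x = 1` (computed in `ℝ`)
  have hpos : (0 : ℝ) < ((modularCharacter (a ^ n) : ℝ≥0) : ℝ) := by exact_mod_cast modularCharacterFun_pos (G := ↥(unitaryGroupOfForm σ J)) (a ^ n)
  have hinv' : (((modularCharacter (a ^ n) : ℝ≥0) : ℝ))⁻¹ = ((modularCharacter (a ^ n) : ℝ≥0) : ℝ) := by
    rw [← NNReal.coe_inv, h1]
  have hxx : ((modularCharacter (a ^ n) : ℝ≥0) : ℝ) * ((modularCharacter (a ^ n) : ℝ≥0) : ℝ) = 1 := by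
    calc ((modularCharacter (a ^ n) : ℝ≥0) : ℝ) * ((modularCharacter (a ^ n) : ℝ≥0) : ℝ)
        = (((modularCharacter (a ^ n) : ℝ≥0) : ℝ))⁻¹ * ((modularCharacter (a ^ n) : ℝ≥0) : ℝ) := by rw [hinv']
      _ = 1 := inv_mul_cancel₀ hpos.ne'
  have hreal : ((modularCharacter (a ^ n) : ℝ≥0) : ℝ) = 1 := by
    rcases mul_self_eq_one_iff.1 hxx with h | h
    · exact h
    · linarith
  exact_mod_cast hreal

include hJ in
/-- **THE MODULAR CHARACTER OF `U(σ, Φ₃)(K)` IS TRIVIAL** (`σ` an isometric involution, `K` with compact valuation ring and a uniformiser, `2, 3 ≠ 0`): every `g` is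
`k₁ aⁿ k₂ z` (★ Cartan), `Δ(kᵢ) = Δ(z) = 1` (compact `K₀ ∋ z`), `Δ(aⁿ) = 1`. [cite: Cartier1979, §I.3] [cite: Folland1995, §2.4] -/
theorem modularCharacter_eq_one (hσ : ∀ x, σ (σ x) = x) (hσv : ∀ x, Valued.v (σ x) = Valued.v x) {ϖ : K} (hϖ : Valued.v ϖ = WithZero.exp (-1 : ℤ))
    (h2 : (2 : K) ≠ 0) (h3 : (3 : K) ≠ 0) (g : ↥(unitaryGroupOfForm σ J)) : modularCharacter g = 1 := by
  have hϖ0 : ϖ ≠ 0 := fun h => by rw [h, map_zero] at hϖ; exact WithZero.zero_ne_coe hϖ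
  have hKc : IsCompact (unitaryInt σ J : Set ↥(unitaryGroupOfForm σ J)) := isCompact_unitaryInt_of_forall_v_eq hσv J
  obtain ⟨a, ha⟩ := exists_coe_eq_diagonal_uniformizer σ hJ hσ hϖ0
  obtain ⟨k₁, hk₁, k₂, hk₂, n, z, hz, hg⟩ := exists_cartan_of_involution σ hJ hσ hσv hϖ a ha g
  rw [comap_glInt_eq_unitaryInt σ hJ hσv] at hk₁ hk₂
  have hzK : z ∈ unitaryInt σ J := center_le_unitaryInt σ hJ hσ hσv h2 h3 hz
  rw [hg, map_mul, map_mul, map_mul, Literature.MeasureTheory.Group.modularCharacter_eq_one_of_mem_isCompact (unitaryInt σ J) hKc hk₁,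
    Literature.MeasureTheory.Group.modularCharacter_eq_one_of_mem_isCompact (unitaryInt σ J) hKc hk₂,
    Literature.MeasureTheory.Group.modularCharacter_eq_one_of_mem_isCompact (unitaryInt σ J) hKc hzK, modularCharacter_pow_ray_eq_one σ hJ hσ hσv hϖ0 a ha n]
  simp

include hJ in
/-- **`U(σ, Φ₃)(K)` IS UNIMODULAR**: every Haar measure on it is right invariant (`(· g)_* μ = Δ(g) • μ`, ★ `map_mul_right_eq_modularCharacter_smul`, and `Δ ≡ 1`).
[cite: Cartier1979, §I.3] [cite: Folland1995, §2.4] -/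
theorem isMulRightInvariant_of_isHaarMeasure (hσ : ∀ x, σ (σ x) = x) (hσv : ∀ x, Valued.v (σ x) = Valued.v x) {ϖ : K}
    (hϖ : Valued.v ϖ = WithZero.exp (-1 : ℤ)) (h2 : (2 : K) ≠ 0) (h3 : (3 : K) ≠ 0)
    (μ : Measure ↥(unitaryGroupOfForm σ J)) [μ.IsHaarMeasure] : μ.IsMulRightInvariant := by
  refine ⟨fun g => ?_⟩
  rw [map_mul_right_eq_modularCharacter_smul μ g, modularCharacter_eq_one σ hJ hσ hσv hϖ h2 h3 g, one_smul]

end Summit.HodgeConjecture.HodgeConjecture.Cruxes.H413.K2E3RankOneUnitaryUnimodular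

end
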